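import Mathlib
import Literature.MathematicalPhysics.QuantumLattice.WilsonDiracAP
import Summits.QuantumFields.QCD.Theorems.QuarksAsStableActionCriticalLineDiamagnetismStubBlockReduction
import Summits.QuantumFields.QCD.Theorems.QuarksAsStableActionCriticalLineDiamagnetismStubBlockClosedForm
import Summits.QuantumFields.QCD.Theorems.QuarksAsStableActionCriticalLineDiamagnetismStubCornerEntryBound

/-!
# Stub P3b — `stub_blockMargin3b`: the crude block margin `−4·𝒦 ≤ Q` on the corner box
(crux stmt-QuantumFields-9734, line `Sketch`, lead c3)

What. For a block twist `θ ∈ (0,π)⁴` in the CORNER box (`min(θ_μ, π − θ_μ) < 1/20` for all four `μ`), scalar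
links `u_μ = e^{iθ_μ}·1`, and every anti-Hermitian tiling-odd link field `Y` on the `2⁴` torus, the one-loop block
Hessian `Q(Y) = ½ Re tr(B0⁻¹ Dl Y B0⁻¹ Dl Y) − ½ Re tr(B0⁻¹ Dl(Y⋆Y))` satisfies `−4·𝒦(Y) ≤ Q(Y)`, where `𝒦` is the
linearised Wilson plaquette form.

How. Assembly of three landed helpers of this line: `stub_blockReduction` (BR: reduction to the per-class
quadratic-form inequality `64γ n(s) |y|² ≤ yᵀ H(s) y` on `1^⊥`), `stub_blockClosedForm` (CF: `H(s)_{μν}` equals the real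
closed form `Hc` for active `μ, ν`) and `stub_cornerEntryBound` (CB: `|Hc| ≤ 256` on the corner box). With `γ = −4`
the per-class inequality is Gershgorin/Cauchy–Schwarz: `yᵀ H y ≥ −256 (Σ_μ |y_μ|)² ≥ −256 · n(s) · |y|²`, since `y`
is supported on the `n(s)` active axes.
-/

noncomputable section

open scoped BigOperators Classical Matrix ComplexConjugate
open Finset
open Literature.MathematicalPhysics.QuantumLattice Literature.MathematicalPhysics.QuantumFieldTheory
  Literature.Probability.LatticeModels

namespace Summit.QuantumFields.QCD.Cruxes.CriticalLineDiamagnetism.ChessboardCellGain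

namespace BlockMargin3b

/-- Gershgorin / Cauchy–Schwarz on the support: if `|H μ ν| ≤ K` whenever `μ, ν` are active, `K ≥ 0`, and `y`
vanishes off the active set `A`, then `−K · |A| · Σ y² ≤ Σ_{μν} H μ ν y_μ y_ν`. -/
theorem form_lower (H : Fin 4 → Fin 4 → ℝ) (A : Finset (Fin 4)) (K : ℝ) (hK : 0 ≤ K)
    (hH : ∀ μ ∈ A, ∀ ν ∈ A, |H μ ν| ≤ K) (y : Fin 4 → ℝ) (hy : ∀ μ, μ ∉ A → y μ = 0) :
    -(K * (A.card : ℝ) * ∑ μ, y μ ^ 2) ≤ ∑ μ, ∑ ν, H μ ν * (y μ * y ν) := by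
  -- termwise bound `H μ ν y_μ y_ν ≥ −K |y_μ| |y_ν|`
  have hterm : ∀ μ ν, -(K * (|y μ| * |y ν|)) ≤ H μ ν * (y μ * y ν) := by
    intro μ ν
    by_cases hμ : μ ∈ A
    · by_cases hν : ν ∈ A
      · have h1 : |H μ ν * (y μ * y ν)| ≤ K * (|y μ| * |y ν|) := by
          rw [abs_mul, abs_mul]
          exact mul_le_mul_of_nonneg_right (hH μ hμ ν hν) (by positivity)
        have := neg_abs_le (H μ ν * (y μ * y ν))
        linarith
      · rw [hy ν hν]; simp
    · rw [hy μ hμ]; simp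
  have hsum : -(K * ∑ μ, ∑ ν, |y μ| * |y ν|) ≤ ∑ μ, ∑ ν, H μ ν * (y μ * y ν) := by
    rw [Finset.mul_sum, ← Finset.sum_neg_distrib]
    refine Finset.sum_le_sum fun μ _ => ?_
    rw [Finset.mul_sum, ← Finset.sum_neg_distrib]
    exact Finset.sum_le_sum fun ν _ => hterm μ ν
  -- `Σ_μν |y_μ||y_ν| = (Σ_μ |y_μ|)² = (Σ_{μ∈A} |y_μ|)² ≤ |A| Σ_{μ∈A} y_μ² ≤ |A| Σ_μ y_μ²`
  have hprod : ∑ μ, ∑ ν, |y μ| * |y ν| = (∑ μ, |y μ|) ^ 2 := by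
    rw [sq, Finset.sum_mul_sum]
  have hsupp : ∑ μ, |y μ| = ∑ μ ∈ A, |y μ| := by
    rw [← Finset.sum_subset (Finset.subset_univ A)]
    intro μ _ hμ; rw [hy μ hμ, abs_zero]
  have hCS : (∑ μ ∈ A, |y μ|) ^ 2 ≤ (A.card : ℝ) * ∑ μ ∈ A, |y μ| ^ 2 := sq_sum_le_card_mul_sum_sq
  have hA : ∑ μ ∈ A, |y μ| ^ 2 ≤ ∑ μ, y μ ^ 2 := by
    calc ∑ μ ∈ A, |y μ| ^ 2 = ∑ μ ∈ A, y μ ^ 2 := Finset.sum_congr rfl fun μ _ => sq_abs _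
      _ ≤ ∑ μ, y μ ^ 2 := Finset.sum_le_sum_of_subset_of_nonneg (Finset.subset_univ A)
          fun μ _ _ => sq_nonneg _
  have hcard : (0 : ℝ) ≤ A.card := Nat.cast_nonneg _
  rw [hprod, hsupp] at hsum
  nlinarith [mul_le_mul_of_nonneg_left hA (mul_nonneg hK hcard)]

end BlockMargin3b

/-- **Stub P3b — `stub_blockMargin3b`** (corner box, crude claim `−4`). Assembly: `stub_blockReduction` with
`γ = −4`, whose per-class hypothesis follows from `stub_blockClosedForm` (the entries are the closed form) and
`stub_cornerEntryBound` (`|entry| ≤ 256`) by `BlockMargin3b.form_lower` (`64 · (−4) · n = −256 · n`). -/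
theorem stub_blockMargin3b : ∀ (θ : Fin 4 → ℝ), (∀ μ, 0 < θ μ ∧ θ μ < Real.pi) → (∀ μ : Fin 4, min (θ μ) (Real.pi - θ μ) < 1 / 20) → ∀ (u : Fin 4 → Matrix.unitaryGroup (Fin 3) ℂ), (∀ μ, ((u μ : Matrix.unitaryGroup (Fin 3) ℂ) : Matrix (Fin 3) (Fin 3) ℂ) = Complex.exp (↑(θ μ) * Complex.I) • (1 : Matrix (Fin 3) (Fin 3) ℂ)) → let B0 : Matrix (TorusSite 4 2 × Fin 3 × Fin 4) (TorusSite 4 2 × Fin 3 × Fin 4) ℂ := wilsonDirac (unitaryFundamentalRep (Fin 3) ℂ) (fun e : Edge 4 2 => u e.2) 0 1; let Dl : (Edge 4 2 → Matrix (Fin 3) (Fin 3) ℂ) → Matrix (TorusSite 4 2 × Fin 3 × Fin 4) (TorusSite 4 2 × Fin 3 × Fin 4) ℂ := fun E => Matrix.of fun p q => -(1 / 2 : ℂ) * ∑ μ : Fin 4, ((if q.1 = Site.shift p.1 μ then ((1 : Matrix (Fin 4) (Fin 4) ℂ) - euclideanGamma μ) p.2.2 q.2.2 * (((u μ : Matrix.unitaryGroup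 (Fin 3) ℂ) : Matrix (Fin 3) (Fin 3) ℂ) * E (p.1, μ)) p.2.1 q.2.1 else 0) + (if p.1 = Site.shift q.1 μ then ((1 : Matrix (Fin 4) (Fin 4) ℂ) + euclideanGamma μ) p.2.2 q.2.2 * (((u μ : Matrix.unitaryGroup (Fin 3) ℂ) : Matrix (Fin 3) (Fin 3) ℂ) * E (q.1, μ))ᴴ p.2.1 q.2.1 else 0)); ∀ Y : Edge 4 2 → Matrix (Fin 3) (Fin 3) ℂ, (∀ e, (Y e)ᴴ = -Y e) → (∀ (x : TorusSite 4 2) (μ : Fin 4), Y (Site.shift x μ, μ) = -Y (x, μ)) → -(4 : ℝ) * (∑ p : Plaquette 4 2, ∑ a, ∑ b, ‖(Y (p.1, p.2.1.1) + Y (Site.shift p.1 p.2.1.1, p.2.1.2) - Y (Site.shift p.1 p.2.1.2, p.2.1.1) - Y (p.1, p.2.1.2)) a b‖ ^ 2) ≤ ((B0⁻¹ * Dl Y * (B0⁻¹ * Dl Y)).trace.re / 2 - (B0⁻¹ * Dl (fun e => Y e * Y e)).trace.re / 2) := by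
  intro θ hθ hc u hu B0 Dl Y hY hodd
  refine stub_blockReduction θ u hθ hu (-4) ?_ Y hY hodd
  intro s y hsupp hsum
  have hCF := stub_blockClosedForm θ hθ
  have hCB := stub_cornerEntryBound θ hθ hc
  have h01 : ∀ a : ZMod 2, a ≠ 1 → a = 0 := by decide
  have key := BlockMargin3b.form_lower _ (Finset.univ.filter fun μ : Fin 4 => s μ = 1) 256 (by norm_num)
    (fun μ hμ ν hν => by
      rw [Finset.mem_filter] at hμ hν
      have e := hCF s μ ν hμ.2 hν.2
      have b := hCB s μ ν hμ.2 hν.2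
      exact (congrArg (fun t : ℝ => |t|) e).trans_le b)
    y (fun μ hμ => hsupp μ (h01 _ fun h1 => hμ (Finset.mem_filter.2 ⟨Finset.mem_univ _, h1⟩)))
  refine le_of_eq_of_le ?_ key
  ring

end Summit.QuantumFields.QCD.Cruxes.CriticalLineDiamagnetism.ChessboardCellGain

end
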